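import Literature.NumberTheory.Sieve.LinearEquationsInPrimesSingularSeries
import Literature.NumberTheory.Sieve.LinearEquationsInPrimesSubsystems
import Literature.NumberTheory.Sieve.SingularSeries
import Literature.NumberTheory.Sieve.BatemanHornParityBoundary
import Mathlib.NumberTheory.AlmostPrime
import HarnessLib

/-!
# Generalised Hardy–Littlewood at the parity boundary: the sieve bounds that hold for EVERY
# affine-linear system, uniformly in the system

Trunk T-SIEVE (`Literature/NumberTheory/Sieve`); companion of `BatemanHornParityBoundary.lean` (ladder
label F-BHΩ, a theorem of the tree: `BatemanHornParityBoundary.Rung_holds`).  The conjunct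
`Summit.Parity.GeneralizedHardyLittlewood` of the summit is Green–Tao's Conjecture 1.2 for ALL
complexities (tree `GeneralizedHardyLittlewood`): uniformly over non-degenerate systems
`Ψ = (ψ₁, …, ψ_t)` of affine-linear forms on `ℤ^d` with `‖Ψ‖_N ≤ L` and convex `K ⊆ [-N, N]^d`,
`∑_{n ∈ K ∩ ℤ^d} ∏ᵢ Λ(ψᵢ(n)) = β_∞ ∏_p β_p + o_{t,d,L}(N^d)` (counting form, Conjecture 1.4 = tree
`GeneralizedHardyLittlewoodCount`: `#{n ∈ K ∩ ℤ^d : ψᵢ(n) prime ∀ i} = (1 + o(1)) β_∞ ∏_p β_p / logᵗ N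
+ o(N^d / logᵗ N)`).  Classical sieve theory proves, for EVERY such system (finite or infinite
complexity: twin primes, Goldbach, prime tuples in several variables alike) and UNIFORMLY in the
system in exactly Green–Tao's sense, two one-sided statements over the same objects
(`primePointCount`, `vonMangoldtSum`, `archFactor` = `β_∞`, `singularProduct` = `∏_p β_p`), and this
file states them as named facts:

* `UpperBoundCount` — **Selberg's upper bound at the parity constant**:
  `#{n ∈ K ∩ ℤ^d : ψᵢ(n) prime ∀ i} ≤ 2ᵗ t! · β_∞ ∏_p β_p / logᵗ N + ε N^d / logᵗ N` for
  `N ≥ N₀(d, t, L, ε)`.  This is Selberg's `Λ²` sieve of dimension `κ = t` (Diamond–Halberstam–Galway,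
  *A Higher-Dimensional Sieve Method*, Thm. 5.6 and Cor. 5.7: under the one-sided condition `Ω(κ)`,
  `S(𝒜, 𝒫, z) ≤ Γ(κ+1) ∏_p (1 − ω(p)/p)(1 − 1/p)^{−κ} X / logᵏ z · {1 + O_{κ,A}(log log 3z / log z)}`
  plus the remainder sum) applied with `z = N^{1/2 − δ}` to the multiset `{∏ᵢ ψᵢ(n) : n ∈ K ∩ ℤ^d, ψᵢ(n) > 0}`,
  whose distribution in residue classes is lattice-point counting in convex bodies (Green–Tao 2010,
  App. A; tree `GreenTao2010_latticePointsConvexBody_holds`) and whose density `ω(p)/p =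
  #{a ∈ 𝔽_p^d : ∏ᵢ ψᵢ(a) = 0}/p^d = 1 − β_p (1 − 1/p)ᵗ` satisfies `Ω(t)` with a constant depending on
  `t, d, L` ONLY (at most `t` hyperplanes: `ω(p) ≤ t + O_{t}(1/p)` for `p > max(t, L)`, whatever the
  constants `ψᵢ(0)`, which may be as large as `LN` — Diamond–Halberstam–Galway Example 1.2 for `d = 1`;
  the exceptional primes of Green–Tao's Lemma 1.3 only DECREASE `ω`, the harmless direction for a
  one-sided hypothesis, cf. Greaves, *Sieves in Number Theory*, §2.3.2, proof of Thm. 3: "The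
  `N`-dependence of `ρ` does not create a problem if Theorem 2.2.2 is used").  The factor `2ᵗ t!` over the
  conjectured main term is the parity-and-dimension loss of the sieve (Greaves §2.3.3: "The bound in
  Theorem 4 exceeds the generally conjectured asymptotic value by the factor `2^k k!`").
  IN PRINT VERBATIM for `d = 1`: Diamond–Halberstam–Galway Example 5.8 (5.47) with linear `hᵢ`
  (fixed system; = the tree's THEOREM `BatemanHornParityBoundary.UpperBound_holds` for `k` linear
  polynomials), Greaves §2.3.2 Thm. 2 (twins, `16 C X / log² X = 8 · 𝔖 X / log² X`) and Thm. 3 (Goldbach,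
  uniform in the even number — recorded below as `GoldbachSelberg`).  For `d ≥ 2` and for the
  uniformity in `Ψ` the statement is the same theorem of the sieve applied to Green–Tao's counting
  (App. A) and local factors (Lemma 1.3); we know no printed statement at this generality and say so.
* `UpperBound` — the same bound in the von Mangoldt-weighted shape of Conjecture 1.2:
  `∑_{n ∈ K ∩ ℤ^d} ∏ᵢ Λ(ψᵢ(n)) ≤ 2ᵗ t! · β_∞ ∏_p β_p + ε N^d` (from `UpperBoundCount` by `Λ(ψᵢ(n)) ≤
  log(2LN)`, tree `prod_intVonMangoldt_le`, and the prime-power and small-value estimates of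
  `LinearEquationsInPrimesCrudeBounds.lean`).
* `AlmostPrimes` — **almost-prime points**: for `r = r(d, t, L)` and `c = c(d, t, L) > 0`,
  `#{n ∈ K ∩ ℤ^d : ψᵢ(n) > 0 ∀ i, Ω(∏ᵢ ψᵢ(n)) ≤ r} ≥ c · β_∞ ∏_p β_p / logᵗ N − ε N^d / logᵗ N` for
  `N ≥ N₀(d, t, L, ε)` — the Fundamental Lemma (tree `SieveSequence.fundamental_lemma_uniform_holds`,
  which asks exactly the one-sided `Ω(κ)` = `HasSieveDimension`) at `z = N^{1/(4s)}`, Mertens' theorem,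
  and `Ω ≤ r` for `z`-rough values `≤ (2LN)ᵗ` (Halberstam–Richert Thm. 10.4 / Diamond–Halberstam–Galway
  §11.5 (11.24) give the sharp `r`; for `d = 1` fixed systems this is the tree's THEOREM
  `BatemanHornParityBoundary.AlmostPrimes_holds`).
* `GoldbachSelberg` — the printed uniform instance `d = 1, t = 2`: for even `N`,
  `R(N) = #{(p, q) : p + q = N} ≤ (8 + ε) 𝔖(N) N / log² N`, `𝔖(N) = 2 C₂ ∏_{p ∣ N, p > 2} (p−1)/(p−2)`
  (Greaves §2.3.2 Thm. 3: `F₂(N) ≤ 16 C N / log² N · ∏_{2 < p ∣ N} (p−1)/(p−2) · (1 + O(log log N / log N))`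
  with `C = ∏_{p > 2} p(p−2)/(p−1)² = C₂`, i.e. `16 C ∏ = 8 𝔖(N)`; tree objects
  `SingularSeries.goldbachCount`, `goldbachSingularSeries`; the tree so far has only the Brun-type bound
  `goldbachCount m ≤ C N (log log N)³ / log² N` of `BrunGoldbach.lean`).  It is the case
  `Ψ_N = (n, N − n)`, `K = [0, N]`, `L = 3` of `UpperBoundCount` (`β_∞ = N`, `∏_p β_p = 𝔖(N)`).
* `Rung := UpperBoundCount ∧ AlmostPrimes` — «generalised Hardy–Littlewood at the parity boundary, for
  every system of every complexity» (ladder label F-GHLΩ, the twin of F-BHΩ on the other conjunct).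

PROVED here (on-path certificates, no sieve theory): `upperBoundCount_of_count`,
`upperBound_of_generalizedHardyLittlewood`, `almostPrimes_of_count`, `rung_of_count` — the rung and
its pieces FOLLOW from the conjunct (Conjecture 1.4, resp. 1.2), so every `_holds` theorem is a
one-sided theorem ON THE PATH to `Summit.Parity.GeneralizedHardyLittlewood`, not beside it; and
`primePointCount_le_almostPrimePointCount` (a prime point is an almost-prime point for `r ≥ t`).

HONESTY LABEL. Formalisation-first of classical theorems; all statements sit INSIDE the parity
barrier (`Literature.Barriers.Parity.SelbergParity`, Selberg's examples: the constant `2ᵗ t!` cannot be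
lowered to `< 2ᵗ t! / 2`… by any sieve of this type, and for `t = 1` Bombieri's asymptotic sieve shows the
factor `2` is sharp for the method) and claim no new prime point of any system.  What is new relative
to the tree is (i) several variables `d ≥ 2` and (ii) uniformity in the system with constants up to
`LN` (Goldbach-type systems), i.e. exactly Green–Tao's quantifier shape with the conjectured `=`
replaced by the two provable inequalities.  `UpperBoundCount`, `UpperBound`, `AlmostPrimes`,
`GoldbachSelberg` are hypotheses `(h : UpperBoundCount)` etc. until their `_holds` theorems land.
Plan of the proofs (for the literature seats; sizes are estimates): (L1) the sieve sequence of a system —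
`a_m = #{n ∈ K ∩ ℤ^d : ψᵢ(n) > 0, ∏ᵢ ψᵢ(n) = m}`, density `ω_Ψ(m)/m^d` multiplicative by the Chinese
remainder theorem on `(ℤ/m)^d`, `|R_m| ≤ ω_Ψ(m) · C_d ((N/m)^{d−1} + 1)` by App. A in each residue class
(≈ 0.9–1.4 kloc); (L2) `Ω(t)` with `K = K(t, d, L)` uniformly, via the tree's `hasSieveDimension_of_le_div`
(≈ 0.3 kloc); (L3) `AlmostPrimes_holds` by the uniform Fundamental Lemma (≈ 0.6–0.9 kloc; model:
`BatemanHornAlmostPrimes.lean`); (L4) the effective lower bound for Selberg's sum under a ONE-SIDED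
density hypothesis — Greaves §2.2.2 Thm. 2: `G(z) ≥ e^{−γκ} / (Γ(κ+1) V(P(z))) · (1 + O_κ(A / log z))` if
`∑_{p < v} g(p) log p ≤ κ log v + A` — over the tree's `SelbergSieve.selbergSum` (≈ 1.2–1.8 kloc; the
tree's F-BHΩ proof used Karamata's Tauberian theorem instead, which is not uniform in the system);
(L5) `UpperBoundCount_holds` from the tree's `SelbergSieve.siftedSum_le_totalMass_div_selbergSum_add`,
(L1), (L2), (L4) (≈ 0.7–1.0 kloc) and `UpperBound_holds` from it (≈ 0.2 kloc); (L6) `GoldbachSelberg_holds`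
as the instance `(n, N − n)` (dictionary ≈ 0.3–0.5 kloc, model: `LinearEquationsInPrimesTwinSystem.lean`).

## References
* H. G. Diamond, H. Halberstam, W. F. Galway, *A Higher-Dimensional Sieve Method*, Cambridge Tracts
  177, CUP (2008): Example 1.2 and §1.4 (the `Ω(κ)` condition, `Ω(g)` for `g` linear forms); Thm. 5.6,
  Cor. 5.7; §5.4 Example 5.8 (5.47); §11.5 (11.24), Example 11.3. [DiamondHalberstamGalway2008]
* G. Greaves, *Sieves in Number Theory*, Springer (2001): §2.2.2 Thm. 2 (one-sided density ⇒
  `G(z) ≥ e^{−γκ}/(Γ(κ+1)V(P(z)))(1 + O(A/log z))`), §2.3.2 Thm. 2 (twins `16 C X/log² X`), Thm. 3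
  (Goldbach `16 C N/log² N ∏_{2<p∣N}(p−1)/(p−2)`), §2.3.3 Thm. 4 and the remark on the factor `2^k k!`.
  [Greaves2001]
* H. Halberstam, H.-E. Richert, *Sieve Methods*, Academic Press (1974): Thm. 5.3 (prime `k`-tuples of
  linear forms), Thm. 10.4. [HalberstamRichert1974]
* B. Green, T. Tao, *Linear equations in primes*, Ann. of Math. (2) 171 (2010) 1753–1850: Conj. 1.2,
  Conj. 1.4, Lemma 1.3, App. A. [GreenTao2010]
-/

open Filter Finset MeasureTheory

namespace Literature.NumberTheory.Sieve

namespace GHLParityBoundary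

/-! ### The almost-prime point count of a system -/

open scoped Classical in
/-- `#{n ∈ K ∩ ℤ^d : ψᵢ(n) > 0 for all i, and Ω(∏ᵢ ψᵢ(n)) ≤ r}` for `K ⊆ [-N, N]^d`: the number of
lattice points of `K` (multiplicity conventions of `primePointCount`) at which all forms are positive and
their product is a `P_r` (`Nat.IsAtMostAlmostPrime r m ↔ m ≠ 0 ∧ Ω m ≤ r`, Mathlib). [folklore] -/
noncomputable def almostPrimePointCount {d t : ℕ} (Ψ : Fin t → AffLinForm d) (K : Set (Fin d → ℝ))
    (N r : ℕ) : ℕ :=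
  #((latticeBox d N).filter fun n : Fin d → ℤ =>
    realPoint n ∈ K ∧ (∀ i, 0 < (Ψ i).eval n) ∧
      Nat.IsAtMostAlmostPrime r (∏ i, ((Ψ i).eval n).toNat))

/-! ### The named facts -/

/-- **Selberg's upper bound for the prime points of an affine-linear system, at the parity constant
`2ᵗ t!`, uniformly in the system** (the counting shape of Green–Tao 2010, (1.8)).  For `d, t ≥ 1`, `L`
and `ε > 0` there is `N₀` such that for all `N ≥ N₀`, all non-degenerate `Ψ : ℤ^d → ℤ^t` with
`‖Ψ‖_N ≤ L` and all convex `K ⊆ [-N, N]^d`,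
`#{n ∈ K ∩ ℤ^d : ψᵢ(n) prime ∀ i} ≤ 2ᵗ t! · β_∞ ∏_p β_p / logᵗ N + ε N^d / logᵗ N`.
Selberg's `Λ²` sieve of dimension `t` under `Ω(t)` (Diamond–Halberstam–Galway Thm. 5.6, Cor. 5.7), the
condition holding with a constant depending on `t, d, L` only, applied to the lattice points of `K`
(Green–Tao App. A); printed verbatim for `d = 1` (DHG Example 5.8 (5.47), linear case; Greaves §2.3.2
Thms. 2–3), derived as described in the module docstring for `d ≥ 2`.
[cite: DiamondHalberstamGalway2008, Thm. 5.6, Cor. 5.7 and Example 5.8 (5.47)]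
[cite: GreenTao2010, (1.8), Lemma 1.3 and App. A] -/
def UpperBoundCount : Prop :=
  ∀ (d t L : ℕ), 1 ≤ d → 1 ≤ t → ∀ ε : ℝ, 0 < ε → ∃ N₀ : ℕ, ∀ N : ℕ, N₀ ≤ N →
    ∀ Ψ : Fin t → AffLinForm d, IsNondegenerateSystem Ψ → affLinSize Ψ N ≤ L →
      ∀ K : Set (Fin d → ℝ), Convex ℝ K → K ⊆ realBox d N →
        (primePointCount Ψ K N : ℝ) ≤
          2 ^ t * (t.factorial : ℝ) * archFactor Ψ K * singularProduct Ψ / Real.log N ^ t +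
            ε * (N : ℝ) ^ d / Real.log N ^ t

/-- **The one-sided generalised Hardy–Littlewood inequality at the parity constant** (the shape of
the asymptotic (1.2)–(1.7) of Green–Tao 2010 with `=` replaced by `≤ 2ᵗ t! ×`): for `d, t ≥ 1`, `L`, `ε > 0` and
`N ≥ N₀(d, t, L, ε)`, uniformly in non-degenerate `Ψ` with `‖Ψ‖_N ≤ L` and convex `K ⊆ [-N, N]^d`,
`∑_{n ∈ K ∩ ℤ^d} ∏ᵢ Λ(ψᵢ(n)) ≤ 2ᵗ t! · β_∞ ∏_p β_p + ε N^d`.  From `UpperBoundCount` by `Λ(ψᵢ(n)) ≤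
log(2LN)` and the estimates of `LinearEquationsInPrimesCrudeBounds.lean` (prime powers and small values
contribute `o(N^d)`).
[cite: DiamondHalberstamGalway2008, Cor. 5.7] [cite: GreenTao2010, (1.2) and §4] -/
def UpperBound : Prop :=
  ∀ (d t L : ℕ), 1 ≤ d → 1 ≤ t → ∀ ε : ℝ, 0 < ε → ∃ N₀ : ℕ, ∀ N : ℕ, N₀ ≤ N →
    ∀ Ψ : Fin t → AffLinForm d, IsNondegenerateSystem Ψ → affLinSize Ψ N ≤ L →
      ∀ K : Set (Fin d → ℝ), Convex ℝ K → K ⊆ realBox d N →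
        vonMangoldtSum Ψ K N ≤
          2 ^ t * (t.factorial : ℝ) * (archFactor Ψ K * singularProduct Ψ) + ε * (N : ℝ) ^ d

/-- **Almost-prime points of an affine-linear system, uniformly in the system.**  For `d, t ≥ 1` and `L`
there are `r = r(d, t, L)` and `c = c(d, t, L) > 0` such that for every `ε > 0` and `N ≥ N₀(d, t, L, ε)`,
uniformly in non-degenerate `Ψ` with `‖Ψ‖_N ≤ L` and convex `K ⊆ [-N, N]^d`,
`#{n ∈ K ∩ ℤ^d : ψᵢ(n) > 0 ∀ i, Ω(∏ᵢ ψᵢ(n)) ≤ r} ≥ c · β_∞ ∏_p β_p / logᵗ N − ε N^d / logᵗ N`.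
The Fundamental Lemma under `Ω(t)` (Halberstam–Richert Thm. 2.5 / Thm. 10.4; Diamond–Halberstam–Galway
§11.5 (11.24) for the sharp `r`), Mertens' theorem along the system, and `Ω ≤ r` for rough values.
[cite: HalberstamRichert1974, Thm. 10.4] [cite: DiamondHalberstamGalway2008, §11.5 (11.24)] -/
def AlmostPrimes : Prop :=
  ∀ (d t L : ℕ), 1 ≤ d → 1 ≤ t → ∃ r : ℕ, ∃ c : ℝ, 0 < c ∧ ∀ ε : ℝ, 0 < ε → ∃ N₀ : ℕ,
    ∀ N : ℕ, N₀ ≤ N →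
      ∀ Ψ : Fin t → AffLinForm d, IsNondegenerateSystem Ψ → affLinSize Ψ N ≤ L →
        ∀ K : Set (Fin d → ℝ), Convex ℝ K → K ⊆ realBox d N →
          c * archFactor Ψ K * singularProduct Ψ / Real.log N ^ t -
              ε * (N : ℝ) ^ d / Real.log N ^ t ≤
            (almostPrimePointCount Ψ K N r : ℝ)

/-- **Selberg's upper bound for the Goldbach representation number, uniform in the even number**
(Greaves §2.3.2 Thm. 3: `F₂(N) ≤ 16 C N / log² N · ∏_{2 < p ∣ N} (p−1)/(p−2) · (1 + O(log log N / log N))`,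
`C = ∏_{p>2} p(p−2)/(p−1)²`; in the tree's notation `16 C ∏ = 8 · 𝔖(N)` with
`𝔖(N) = goldbachSingularSeries N = 2 C₂ ∏_{p ∣ N, p > 2} (p−1)/(p−2)`, `R(N) = SingularSeries.goldbachCount N`
over ordered pairs), rendered qualitatively: for every `ε > 0` and all large EVEN `N`,
`R(N) ≤ (8 + ε) 𝔖(N) N / log² N`.  The instance `Ψ_N = (n, N − n)`, `K = [0, N]`, `L = 3` of
`UpperBoundCount`; the factor over the Hardy–Littlewood main term `𝔖(N) N / log² N` is `2² · 2! = 8`.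
[cite: Greaves2001, §2.3.2 Theorem 3] -/
def GoldbachSelberg : Prop :=
  ∀ ε : ℝ, 0 < ε → ∀ᶠ N : ℕ in atTop, Even N →
    (SingularSeries.goldbachCount N : ℝ) ≤
      (8 + ε) * goldbachSingularSeries N * (N : ℝ) / Real.log N ^ 2

/-! ### The rung -/

/-- THE RUNG (ladder label F-GHLΩ): generalised Hardy–Littlewood at the parity boundary,
for every system of every complexity, uniformly in the system = the conjunction of Selberg's upper
bound in counting form (`UpperBoundCount`) and the almost-prime lower bound (`AlmostPrimes`).
[cite: DiamondHalberstamGalway2008, Cor. 5.7 and §11.5 (11.24)] -/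
def Rung : Prop := UpperBoundCount ∧ AlmostPrimes

/-! ### On-path certificates: the rung follows from the conjunct (Conjecture 1.4 / 1.2) -/

/-- A product of primes indexed by a finset `s` has at most `#s` prime factors (in fact exactly).
[folklore] -/
private theorem isAtMostAlmostPrime_prod_of_prime {ι : Type*} (s : Finset ι) (f : ι → ℕ)
    (hf : ∀ i ∈ s, (f i).Prime) : Nat.IsAtMostAlmostPrime s.card (∏ i ∈ s, f i) := by
  classical
  induction s using Finset.induction_on with
  | empty => exact ⟨by simp, by simp⟩
  | insert a s ha ih =>
    rw [Finset.prod_insert ha, Finset.card_insert_of_notMem ha, Nat.add_comm]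
    exact ((hf a (Finset.mem_insert_self a s)).isAlmostPrime_one.isAtMost le_rfl).mul
      (ih fun i hi => hf i (Finset.mem_insert_of_mem hi))

/-- A prime point is an almost-prime point as soon as `r ≥ t`:
`primePointCount Ψ K N ≤ almostPrimePointCount Ψ K N r` (a prime `t`-tuple point is a `P_t` point,
Diamond–Halberstam–Galway §1.3). [cite: DiamondHalberstamGalway2008, §1.3 (prime g-tuples, P_r)] -/
theorem primePointCount_le_almostPrimePointCount {d t : ℕ} (Ψ : Fin t → AffLinForm d)
    (K : Set (Fin d → ℝ)) (N : ℕ) {r : ℕ} (hr : t ≤ r) :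
    primePointCount Ψ K N ≤ almostPrimePointCount Ψ K N r := by
  classical
  unfold primePointCount almostPrimePointCount
  refine Finset.card_le_card fun n hn => ?_
  rw [Finset.mem_filter] at hn ⊢
  obtain ⟨hbox, hK, hp⟩ := hn
  refine ⟨hbox, hK, fun i => ?_, ?_⟩
  · by_contra hle
    have hpi := hp i
    rw [Int.toNat_of_nonpos (not_lt.mp hle)] at hpi
    exact Nat.not_prime_zero hpi
  · have h := isAtMostAlmostPrime_prod_of_prime (Finset.univ : Finset (Fin t))
      (fun i => ((Ψ i).eval n).toNat) fun i _ => hp i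
    rw [Finset.card_univ, Fintype.card_fin] at h
    exact ⟨h.1, h.2.trans hr⟩

/-- `∏_p β_p ≥ 0` for a non-degenerate system: the ordered partial products are non-negative
(`localFactor_nonneg`) and converge (Green–Tao Lemma 1.3, tree `tendsto_singularProductPartial_holds`).
The same statement is proved problem-side as
`Summit.Parity.GeneralizedHardyLittlewood.Cruxes.CellParityLaw.SectionAnnihilator.SingularRatio.singularProduct_nonneg`
(`Summits/…/LeeYangFibresCellParityLawSingularRatio.lean`, not importable into `Literature/`); restated here.
[cite: GreenTao2010, Lemma 1.3] -/
theorem singularProduct_nonneg_of_isNondegenerateSystem {d t : ℕ} {Ψ : Fin t → AffLinForm d}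
    (hΨ : IsNondegenerateSystem Ψ) : 0 ≤ singularProduct Ψ :=
  ge_of_tendsto' (tendsto_singularProductPartial_holds d t Ψ hΨ) fun _ =>
    Finset.prod_nonneg fun p _ => localFactor_nonneg Ψ p

/-- `2 ≤ 2ᵗ · t!` for `t ≥ 1`. [folklore] -/
private theorem two_le_two_pow_mul_factorial {t : ℕ} (ht : 1 ≤ t) : (2 : ℝ) ≤ 2 ^ t * (t.factorial : ℝ) := by
  have h1 : (2 : ℝ) ≤ 2 ^ t := by
    calc (2 : ℝ) = 2 ^ 1 := by norm_num
      _ ≤ 2 ^ t := pow_le_pow_right₀ (by norm_num) ht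
  have h2 : (1 : ℝ) ≤ (t.factorial : ℝ) := by exact_mod_cast t.factorial_pos
  nlinarith

/-- ON-PATH CERTIFICATE for `UpperBoundCount`: it follows from the counting form of the conjunct
(Green–Tao Conj. 1.4, tree `GeneralizedHardyLittlewoodCount`): the conjecture's upper half with
`ε' = min(ε, 1)` gives `count ≤ (1 + ε') β_∞ ∏β_p / logᵗ N + ε' N^d / logᵗ N` and `1 + ε' ≤ 2 ≤ 2ᵗ t!`
(all terms non-negative by `archFactor_nonneg`, `singularProduct_nonneg_of_isNondegenerateSystem`);
Greaves §2.3.3: the sieve bound «exceeds the generally conjectured asymptotic value by the factor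
`2^k k!`». [cite: Greaves2001, §2.3.3 Theorem 4 (remark)] [cite: GreenTao2010, Conj. 1.4] -/
theorem upperBoundCount_of_count (h : GeneralizedHardyLittlewoodCount) : UpperBoundCount := by
  intro d t L hd ht ε hε
  obtain ⟨N₀, hN₀⟩ := h d t L hd ht (min ε 1) (lt_min hε one_pos)
  refine ⟨N₀, fun N hN Ψ hΨ hL K hK hKN => ?_⟩
  have hmain := (abs_le.mp (hN₀ N hN Ψ hΨ hL K hK hKN)).2
  have hm1 : min ε 1 ≤ 1 := min_le_right _ _
  have hmε : min ε 1 ≤ ε := min_le_left _ _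
  have hlg : 0 ≤ Real.log N ^ t := pow_nonneg (Real.log_natCast_nonneg N) t
  have hM : 0 ≤ archFactor Ψ K * singularProduct Ψ :=
    mul_nonneg (archFactor_nonneg Ψ K) (singularProduct_nonneg_of_isNondegenerateSystem hΨ)
  have hMl : 0 ≤ archFactor Ψ K * singularProduct Ψ / Real.log N ^ t := div_nonneg hM hlg
  have hNl : 0 ≤ (N : ℝ) ^ d / Real.log N ^ t := div_nonneg (by positivity) hlg
  have h2t := two_le_two_pow_mul_factorial ht
  have split : min ε 1 * (archFactor Ψ K * singularProduct Ψ + (N : ℝ) ^ d) / Real.log N ^ t =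
      min ε 1 * (archFactor Ψ K * singularProduct Ψ / Real.log N ^ t) +
        min ε 1 * ((N : ℝ) ^ d / Real.log N ^ t) := by ring
  have e1 : 2 ^ t * (t.factorial : ℝ) * archFactor Ψ K * singularProduct Ψ / Real.log N ^ t =
      2 ^ t * (t.factorial : ℝ) * (archFactor Ψ K * singularProduct Ψ / Real.log N ^ t) := by ring
  have e2 : ε * (N : ℝ) ^ d / Real.log N ^ t = ε * ((N : ℝ) ^ d / Real.log N ^ t) := by ring
  rw [e1, e2]
  rw [split] at hmain
  have i1 : (1 + min ε 1) * (archFactor Ψ K * singularProduct Ψ / Real.log N ^ t) ≤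
      2 ^ t * (t.factorial : ℝ) * (archFactor Ψ K * singularProduct Ψ / Real.log N ^ t) :=
    mul_le_mul_of_nonneg_right (by linarith) hMl
  have i2 : min ε 1 * ((N : ℝ) ^ d / Real.log N ^ t) ≤ ε * ((N : ℝ) ^ d / Real.log N ^ t) :=
    mul_le_mul_of_nonneg_right hmε hNl
  linarith

/-- ON-PATH CERTIFICATE for `UpperBound`: it follows from the conjunct itself (Green–Tao Conj. 1.2,
tree `GeneralizedHardyLittlewood`): `∑ ∏ Λ ≤ β_∞ ∏β_p + ε N^d ≤ 2ᵗ t! β_∞ ∏β_p + ε N^d`, the main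
term being non-negative. [cite: Greaves2001, §2.3.3 Theorem 4 (remark)] [cite: GreenTao2010, Conj. 1.2] -/
theorem upperBound_of_generalizedHardyLittlewood (h : GeneralizedHardyLittlewood) : UpperBound := by
  intro d t L hd ht ε hε
  obtain ⟨N₀, hN₀⟩ := h d t L hd ht ε hε
  refine ⟨N₀, fun N hN Ψ hΨ hL K hK hKN => ?_⟩
  have hmain := (abs_le.mp (hN₀ N hN Ψ hΨ hL K hK hKN)).2
  have hM : 0 ≤ archFactor Ψ K * singularProduct Ψ :=
    mul_nonneg (archFactor_nonneg Ψ K) (singularProduct_nonneg_of_isNondegenerateSystem hΨ)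
  have h1t : (1 : ℝ) ≤ 2 ^ t * (t.factorial : ℝ) := by
    linarith [two_le_two_pow_mul_factorial ht]
  have hle : archFactor Ψ K * singularProduct Ψ ≤
      2 ^ t * (t.factorial : ℝ) * (archFactor Ψ K * singularProduct Ψ) :=
    le_mul_of_one_le_left hM h1t
  linarith

/-- ON-PATH CERTIFICATE for `AlmostPrimes`: it follows from the counting form of the conjunct
(`GeneralizedHardyLittlewoodCount`) with `r = t`, `c = 1/2`: prime points are almost-prime points
(`primePointCount_le_almostPrimePointCount`) and the conjecture's lower half with `ε' = min(ε, 1/2)`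
gives `count ≥ (1 − ε') β_∞ ∏β_p / logᵗ N − ε' N^d / logᵗ N`.
[cite: GreenTao2010, Conj. 1.4] [cite: DiamondHalberstamGalway2008, §1.3 (prime g-tuples, P_r)] -/
theorem almostPrimes_of_count (h : GeneralizedHardyLittlewoodCount) : AlmostPrimes := by
  intro d t L hd ht
  refine ⟨t, 1 / 2, by norm_num, fun ε hε => ?_⟩
  obtain ⟨N₀, hN₀⟩ := h d t L hd ht (min ε (1 / 2)) (lt_min hε (by norm_num))
  refine ⟨N₀, fun N hN Ψ hΨ hL K hK hKN => ?_⟩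
  have hlow := (abs_le.mp (hN₀ N hN Ψ hΨ hL K hK hKN)).1
  have hle : (primePointCount Ψ K N : ℝ) ≤ (almostPrimePointCount Ψ K N t : ℝ) := by
    exact_mod_cast primePointCount_le_almostPrimePointCount Ψ K N le_rfl
  have hm1 : min ε (1 / 2) ≤ 1 / 2 := min_le_right _ _
  have hmε : min ε (1 / 2) ≤ ε := min_le_left _ _
  have hlg : 0 ≤ Real.log N ^ t := pow_nonneg (Real.log_natCast_nonneg N) t
  have hM : 0 ≤ archFactor Ψ K * singularProduct Ψ :=
    mul_nonneg (archFactor_nonneg Ψ K) (singularProduct_nonneg_of_isNondegenerateSystem hΨ)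
  have hMl : 0 ≤ archFactor Ψ K * singularProduct Ψ / Real.log N ^ t := div_nonneg hM hlg
  have hNl : 0 ≤ (N : ℝ) ^ d / Real.log N ^ t := div_nonneg (by positivity) hlg
  have split : min ε (1 / 2) * (archFactor Ψ K * singularProduct Ψ + (N : ℝ) ^ d) / Real.log N ^ t =
      min ε (1 / 2) * (archFactor Ψ K * singularProduct Ψ / Real.log N ^ t) +
        min ε (1 / 2) * ((N : ℝ) ^ d / Real.log N ^ t) := by ring
  have e1 : 1 / 2 * archFactor Ψ K * singularProduct Ψ / Real.log N ^ t =
      1 / 2 * (archFactor Ψ K * singularProduct Ψ / Real.log N ^ t) := by ring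
  have e2 : ε * (N : ℝ) ^ d / Real.log N ^ t = ε * ((N : ℝ) ^ d / Real.log N ^ t) := by ring
  rw [e1, e2]
  rw [split] at hlow
  have i1 : min ε (1 / 2) * (archFactor Ψ K * singularProduct Ψ / Real.log N ^ t) ≤
      1 / 2 * (archFactor Ψ K * singularProduct Ψ / Real.log N ^ t) :=
    mul_le_mul_of_nonneg_right hm1 hMl
  have i2 : min ε (1 / 2) * ((N : ℝ) ^ d / Real.log N ^ t) ≤ ε * ((N : ℝ) ^ d / Real.log N ^ t) :=
    mul_le_mul_of_nonneg_right hmε hNl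
  linarith

/-- ON-PATH CERTIFICATE for the rung: F-GHLΩ follows from the counting form of the conjunct
(Green–Tao Conj. 1.4). [cite: GreenTao2010, Conj. 1.4] [cite: Greaves2001, §2.3.3 Theorem 4 (remark)] -/
theorem rung_of_count (h : GeneralizedHardyLittlewoodCount) : Rung :=
  ⟨upperBoundCount_of_count h, almostPrimes_of_count h⟩

end GHLParityBoundary

end Literature.NumberTheory.Sieve
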